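import Literature.NumberTheory.Weil1964.WeilGaussScalarMul
import HarnessLib

/-!
# The cross ratio of eight Gauss integrals that decides the `(U(1), U(1))` theta dichotomy:
# `g(x₄) g(x₁) g(x₂) g(αx₃) ‖α‖^{1/2} = (α, -x₁x₂x₃x₄)_v · g(αx₄) g(αx₁) g(αx₂) g(x₃) ‖α‖^{3/2}`

[Weil1964] A. Weil, Acta Math. 111 (1964), Chap. I n° 14, Chap. II n° 27–28, at a finite place `v` of a number field:
four applications of the scaling law `g(αx) γ(1) ‖α‖^{1/2} = (α, x)_v γ(α) g(x)` (★ `weilGauss_mul_eq_hilbertSymbol`)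
and `γ(α)² = (-1, α)_v γ(1)²` (★ `weilIndex_mul_self_eq`) give the title identity (**`weilGauss_crossRatio`**), in which
the Weil indices `γ(1), γ(α)` have cancelled: only a Hilbert symbol survives.  In the cell `hodgecm-mathlib` (h413 road,
SOCKETS-H413 §3 S6 «G2a») this is the number-theoretic core of the CROSS-LINE SIGN of the finite-level characters of
the two rank `1 × 1` oscillator representations attached to skew-hermitian lines `δ₁`, `δ₂ = α δ₁`: with `x₄ = -T/2`,
`αx₁ = A`, `αx₂ = A'`, `αx₃ = A''` (the Gauss coefficients of the trace formula ★ `rankOne_torusTrace_eq_explicit` and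
of the cocycle ★/`rankOne_scalar_cocycle`) the symbol is `(α, -T A A' A''/2)_v = (α, d₁)_v`, i.e. `-1` exactly when
the two lines lie in different classes.  THEOREMS ONLY; count-neutral; HC_CM is proved only modulo the 7 printed
citations until rung 0 closes.

## References
* [Weil1964] A. Weil, Acta Math. 111 (1964) 143–211: Chap. I n° 14 Thm. 2 Cor. 2 p. 162; Chap. II n° 27 p. 175,
  n° 28 (28) p. 177.
* [Omeara1963] O. T. O'Meara, *Introduction to quadratic forms*, §63B (the local Hilbert symbol).
-/

set_option autoImplicit false

noncomputable section

open MeasureTheory Set NumberField IsDedekindDomain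
open scoped NNReal
open Literature.NumberTheory.GaloisRepresentations.IsNonarchimedeanLocalField
open Literature.NumberTheory.Automorphic Literature.NumberTheory.QuadraticForms

namespace Literature.NumberTheory.Weil1964

variable (K : Type) [Field K] [NumberField K] (v : HeightOneSpectrum (𝓞 K))
  [MeasurableSpace (v.adicCompletion K)] [BorelSpace (v.adicCompletion K)]
  (μ : Measure (v.adicCompletion K)) [μ.IsAddHaarMeasure] {ψ : AddChar (v.adicCompletion K) Circle}

omit [MeasurableSpace (v.adicCompletion K)] [BorelSpace (v.adicCompletion K)] in
/-- **`(α, -(x₁x₂x₃x₄))_v = (α,-1)(α,x₁)(α,x₂)(α,x₃)(α,x₄)`** (bilinearity). [cite: Omeara1963, §63B] -/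
theorem hilbertSymbol_neg_prod_four {α x₁ x₂ x₃ x₄ : v.adicCompletion K} (hα : α ≠ 0) (h₁ : x₁ ≠ 0) (h₂ : x₂ ≠ 0)
    (h₃ : x₃ ≠ 0) (h₄ : x₄ ≠ 0) :
    hilbertSymbol (v.adicCompletion K) α (-(x₁ * x₂ * x₃ * x₄)) =
      hilbertSymbol (v.adicCompletion K) α (-1) * hilbertSymbol (v.adicCompletion K) α x₁ *
        hilbertSymbol (v.adicCompletion K) α x₂ * hilbertSymbol (v.adicCompletion K) α x₃ *
          hilbertSymbol (v.adicCompletion K) α x₄ := by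
  rw [show -(x₁ * x₂ * x₃ * x₄) = -1 * x₁ * x₂ * x₃ * x₄ by ring,
    hilbertSymbol_adicCompletion_mul_right K v (by simp [h₁, h₂, h₃]) h₄ hα,
    hilbertSymbol_adicCompletion_mul_right K v (by simp [h₁, h₂]) h₃ hα,
    hilbertSymbol_adicCompletion_mul_right K v (by simp [h₁]) h₂ hα,
    hilbertSymbol_adicCompletion_mul_right K v (neg_ne_zero.2 one_ne_zero) h₁ hα]

/-- **THE CROSS RATIO OF EIGHT GAUSS INTEGRALS**:
`g(x₄) g(x₁) g(x₂) g(αx₃) ‖α‖^{1/2} = (α, -x₁x₂x₃x₄)_v · g(αx₄) g(αx₁) g(αx₂) g(x₃) ‖α‖^{3/2}` for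
`α, x₁, x₂, x₃, x₄ ∈ K_vˣ` — four scalings `g(αx) γ(1) ‖α‖^{1/2} = (α, x) γ(α) g(x)` and `γ(α)² = (-1, α) γ(1)²`; the
Weil indices cancel. [cite: Weil1964, Chap. II n° 28, (28), p. 177; Chap. I n° 14 Thm. 2 Cor. 2, p. 162] -/
theorem weilGauss_crossRatio (hψ : ψ.IsContinuousNontrivial) {α x₁ x₂ x₃ x₄ : v.adicCompletion K} (hα : α ≠ 0)
    (h₁ : x₁ ≠ 0) (h₂ : x₂ ≠ 0) (h₃ : x₃ ≠ 0) (h₄ : x₄ ≠ 0) :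
    weilGauss ψ μ x₄ * weilGauss ψ μ x₁ * weilGauss ψ μ x₂ * weilGauss ψ μ (α * x₃) *
        (Real.sqrt (normAbs (v.adicCompletion K) α) : ℂ) =
      (hilbertSymbol (v.adicCompletion K) α (-(x₁ * x₂ * x₃ * x₄)) : ℂ) *
        (weilGauss ψ μ (α * x₄) * weilGauss ψ μ (α * x₁) * weilGauss ψ μ (α * x₂) * weilGauss ψ μ x₃ *
          (Real.sqrt (normAbs (v.adicCompletion K) α) : ℂ) ^ 3) := by
  haveI : CharZero (v.adicCompletion K) := charZero_of_injective_algebraMap (algebraMap K _).injective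
  have htwo : (2 : v.adicCompletion K) ≠ 0 := two_ne_zero
  -- notation
  set G₁ := weilIndex ψ μ (1 : v.adicCompletion K) with hG₁
  set Ga := weilIndex ψ μ α with hGa
  set r : ℂ := (Real.sqrt (normAbs (v.adicCompletion K) α) : ℂ) with hr
  have hG₁0 : G₁ ≠ 0 := by
    intro h0; have hn := norm_weilIndex μ hψ (one_ne_zero' (v.adicCompletion K)) htwo; rw [← hG₁, h0, norm_zero] at hn
    exact zero_ne_one hn
  -- the four scalings, in the shape `g(αx) G₁ r = S Ga g(x)`
  have L : ∀ {x : v.adicCompletion K}, x ≠ 0 → weilGauss ψ μ (α * x) * G₁ * r =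
      (hilbertSymbol (v.adicCompletion K) α x : ℂ) * Ga * weilGauss ψ μ x := fun hx =>
    weilGauss_mul_eq_hilbertSymbol K v μ hψ hα hx
  have hGa2 : Ga * Ga = (hilbertSymbol (v.adicCompletion K) (-1) α : ℂ) * (G₁ * G₁) := weilIndex_mul_self_eq K v μ hψ hα
  -- the sign bookkeeping: `S₃ = H S₄ S₁ S₂ (-1,α)`
  have hsign : (hilbertSymbol (v.adicCompletion K) α x₃ : ℂ) =
      (hilbertSymbol (v.adicCompletion K) α (-(x₁ * x₂ * x₃ * x₄)) : ℂ) * hilbertSymbol (v.adicCompletion K) α x₄ *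
        hilbertSymbol (v.adicCompletion K) α x₁ * hilbertSymbol (v.adicCompletion K) α x₂ *
          hilbertSymbol (v.adicCompletion K) (-1) α := by
    rw [hilbertSymbol_neg_prod_four K v hα h₁ h₂ h₃ h₄, hilbertSymbol_comm (-1 : v.adicCompletion K) α]
    push_cast
    rcases hilbertSymbol_eq_one_or_eq_neg_one α (-1 : v.adicCompletion K) with hm | hm <;>
    rcases hilbertSymbol_eq_one_or_eq_neg_one α x₁ with e₁ | e₁ <;>
    rcases hilbertSymbol_eq_one_or_eq_neg_one α x₂ with e₂ | e₂ <;>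
    rcases hilbertSymbol_eq_one_or_eq_neg_one α x₃ with e₃ | e₃ <;>
    rcases hilbertSymbol_eq_one_or_eq_neg_one α x₄ with e₄ | e₄ <;>
    simp only [hm, e₁, e₂, e₃, e₄] <;> norm_num
  -- multiply both sides by `G₁³` and compare
  refine mul_left_cancel₀ (pow_ne_zero 3 hG₁0) ?_
  calc G₁ ^ 3 * (weilGauss ψ μ x₄ * weilGauss ψ μ x₁ * weilGauss ψ μ x₂ * weilGauss ψ μ (α * x₃) * r)
      = weilGauss ψ μ x₄ * weilGauss ψ μ x₁ * weilGauss ψ μ x₂ * (G₁ * G₁) * (weilGauss ψ μ (α * x₃) * G₁ * r) := by ring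
    _ = weilGauss ψ μ x₄ * weilGauss ψ μ x₁ * weilGauss ψ μ x₂ * (G₁ * G₁) *
          ((hilbertSymbol (v.adicCompletion K) α x₃ : ℂ) * Ga * weilGauss ψ μ x₃) := by rw [L h₃]
    _ = weilGauss ψ μ x₄ * weilGauss ψ μ x₁ * weilGauss ψ μ x₂ * (G₁ * G₁) *
          ((hilbertSymbol (v.adicCompletion K) α (-(x₁ * x₂ * x₃ * x₄)) : ℂ) * hilbertSymbol (v.adicCompletion K) α x₄ *
            hilbertSymbol (v.adicCompletion K) α x₁ * hilbertSymbol (v.adicCompletion K) α x₂ *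
            hilbertSymbol (v.adicCompletion K) (-1) α * Ga * weilGauss ψ μ x₃) := by rw [← hsign]
    _ = (hilbertSymbol (v.adicCompletion K) α (-(x₁ * x₂ * x₃ * x₄)) : ℂ) * hilbertSymbol (v.adicCompletion K) α x₄ *
          hilbertSymbol (v.adicCompletion K) α x₁ * hilbertSymbol (v.adicCompletion K) α x₂ * Ga *
          ((hilbertSymbol (v.adicCompletion K) (-1) α : ℂ) * (G₁ * G₁)) *
          (weilGauss ψ μ x₄ * weilGauss ψ μ x₁ * weilGauss ψ μ x₂ * weilGauss ψ μ x₃) := by ring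
    _ = (hilbertSymbol (v.adicCompletion K) α (-(x₁ * x₂ * x₃ * x₄)) : ℂ) * hilbertSymbol (v.adicCompletion K) α x₄ *
          hilbertSymbol (v.adicCompletion K) α x₁ * hilbertSymbol (v.adicCompletion K) α x₂ * Ga * (Ga * Ga) *
          (weilGauss ψ μ x₄ * weilGauss ψ μ x₁ * weilGauss ψ μ x₂ * weilGauss ψ μ x₃) := by rw [← hGa2]
    _ = (hilbertSymbol (v.adicCompletion K) α (-(x₁ * x₂ * x₃ * x₄)) : ℂ) *
          (((hilbertSymbol (v.adicCompletion K) α x₄ : ℂ) * Ga * weilGauss ψ μ x₄) *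
            ((hilbertSymbol (v.adicCompletion K) α x₁ : ℂ) * Ga * weilGauss ψ μ x₁) *
            ((hilbertSymbol (v.adicCompletion K) α x₂ : ℂ) * Ga * weilGauss ψ μ x₂)) * weilGauss ψ μ x₃ := by ring
    _ = (hilbertSymbol (v.adicCompletion K) α (-(x₁ * x₂ * x₃ * x₄)) : ℂ) *
          ((weilGauss ψ μ (α * x₄) * G₁ * r) * (weilGauss ψ μ (α * x₁) * G₁ * r) *
            (weilGauss ψ μ (α * x₂) * G₁ * r)) * weilGauss ψ μ x₃ := by rw [← L h₄, ← L h₁, ← L h₂]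
    _ = G₁ ^ 3 * ((hilbertSymbol (v.adicCompletion K) α (-(x₁ * x₂ * x₃ * x₄)) : ℂ) *
          (weilGauss ψ μ (α * x₄) * weilGauss ψ μ (α * x₁) * weilGauss ψ μ (α * x₂) * weilGauss ψ μ x₃ * r ^ 3)) := by
          ring

omit [MeasurableSpace (v.adicCompletion K)] [BorelSpace (v.adicCompletion K)] in
/-- **The norm-one cocycle identity** (pure algebra): for `a² - d b² = 1`, `a'² - d b'² = 1` and the product point
`a'' = aa' + dbb'`, `b'' = ab' + a'b`:  `8 (1-a)(1-a')(1-a'') = -d · (P b'' - R (1-a''))²` with `P = (1-a)(1-a') + dbb'`,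
`R = (1-a) b' + (1-a') b` — so `-(1-a)(1-a')(1-a'')/2` is `d` times a square. [cite: Weil1964, Chap. I n° 14
(the quadratic characters attached to a form), p. 161–162] -/
theorem eight_mul_oneSub_mul_oneSub_mul_oneSub_eq (a b a' b' d : v.adicCompletion K) (h₁ : a ^ 2 - d * b ^ 2 = 1)
    (h₂ : a' ^ 2 - d * b' ^ 2 = 1) :
    8 * (1 - a) * (1 - a') * (1 - (a * a' + d * (b * b'))) =
      -d * (((1 - a) * (1 - a') + d * b * b') * (a * b' + b * a') -
        ((1 - a) * b' + (1 - a') * b) * (1 - (a * a' + d * (b * b')))) ^ 2 := by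
  linear_combination
    (-(-7 * b' ^ 2 * d - 8 * a' + 8 * a' ^ 2 - 2 * b * b' * d + 2 * b * b' ^ 3 * d ^ 2 + 4 * b * a' * b' * d -
      2 * b * a' ^ 2 * b' * d + b ^ 2 * b' ^ 2 * d ^ 2 + 4 * a * b' ^ 2 * d - a ^ 2 * b' ^ 2 * d)) * h₁ +
    (-(8 - 4 * b * b' * d + b ^ 2 * d + b ^ 2 * b' ^ 2 * d ^ 2 + 4 * b ^ 2 * a' * d - b ^ 2 * a' ^ 2 * d - 8 * a +
      4 * a * b * b' * d)) * h₂

omit [MeasurableSpace (v.adicCompletion K)] [BorelSpace (v.adicCompletion K)] in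
/-- **THE CROSS-LINE SIGN IS `(α, d)_v`.**  In the coordinates of the rank-one trace formula — `β = d b/τ`,
`β' = d b'/τ`, `β'' = d b''/τ`, Gauss coefficients `A = (1-a)/β`, `A' = (1-a')/β'`, `A'' = (1-a'')/β''` and cocycle
parameter `T = β'((a/β + a'/β') β')` on the line `δ₁` (`δ₁² = d`), and `A/α, A'/α, A''/α, αT` on the line `δ₂ = α δ₁` —
the Hilbert symbol of the cross ratio ★ `weilGauss_crossRatio` (`x₁ = A/α, x₂ = A'/α, x₃ = A''/α, x₄ = -T/2`) is
`(α, -x₁x₂x₃x₄)_v = (α, d)_v`: by `eight_mul_oneSub_mul_oneSub_mul_oneSub_eq` the argument is `(-α) · d ·` square, and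
`(α, -α)_v = 1`.  So the two finite-level characters are proportional by a CHARACTER exactly when `α` is a norm from
`K_v(√d)`, and by `-1` times a character otherwise. [cite: Weil1964, Chap. I n° 14 Thm. 2 Cor. 2, p. 162; Omeara1963 §63B] -/
theorem hilbertSymbol_crossRatio_eq {α a b a' b' d τ β β' β'' A A' A'' T : v.adicCompletion K} (hα : α ≠ 0)
    (h₁ : a ^ 2 - d * b ^ 2 = 1) (h₂ : a' ^ 2 - d * b' ^ 2 = 1) (hβ : β = d * b * τ⁻¹) (hβ' : β' = d * b' * τ⁻¹)
    (hβ'' : β'' = d * (a * b' + b * a') * τ⁻¹) (hβ0 : β ≠ 0) (hβ'0 : β' ≠ 0) (hβ''0 : β'' ≠ 0)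
    (hA : A = β⁻¹ * (1 - a)) (hA' : A' = β'⁻¹ * (1 - a')) (hA'' : A'' = β''⁻¹ * (1 - (a * a' + d * (b * b'))))
    (hA0 : A ≠ 0) (hA'0 : A' ≠ 0) (hA''0 : A'' ≠ 0) (hT : T = β' * ((β⁻¹ * a + a' * β'⁻¹) * β')) :
    hilbertSymbol (v.adicCompletion K) α (-(α⁻¹ * A * (α⁻¹ * A') * (α⁻¹ * A'') * -((2 : v.adicCompletion K)⁻¹ * T))) =
      hilbertSymbol (v.adicCompletion K) α d := by
  haveI : CharZero (v.adicCompletion K) := charZero_of_injective_algebraMap (algebraMap K _).injective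
  have htwo : (2 : v.adicCompletion K) ≠ 0 := two_ne_zero
  have hd0 : d ≠ 0 := (mul_ne_zero_iff.1 (mul_ne_zero_iff.1 (hβ ▸ hβ0)).1).1
  have hb0 : b ≠ 0 := (mul_ne_zero_iff.1 (mul_ne_zero_iff.1 (hβ ▸ hβ0)).1).2
  have hτ0 : τ ≠ 0 := fun h => (mul_ne_zero_iff.1 (hβ ▸ hβ0)).2 (by rw [h, inv_zero])
  have hb''0 : a * b' + b * a' ≠ 0 := (mul_ne_zero_iff.1 (mul_ne_zero_iff.1 (hβ'' ▸ hβ''0)).1).2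
  have h1a : 1 - a ≠ 0 := (mul_ne_zero_iff.1 (hA ▸ hA0)).2
  have h1a' : 1 - a' ≠ 0 := (mul_ne_zero_iff.1 (hA' ▸ hA'0)).2
  have h1a'' : 1 - (a * a' + d * (b * b')) ≠ 0 := (mul_ne_zero_iff.1 (hA'' ▸ hA''0)).2
  -- the numerator of the square
  set f := ((1 - a) * (1 - a') + d * b * b') * (a * b' + b * a') -
    ((1 - a) * b' + (1 - a') * b) * (1 - (a * a' + d * (b * b'))) with hf
  have hX := eight_mul_oneSub_mul_oneSub_mul_oneSub_eq K v a b a' b' d h₁ h₂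
  have hf0 : f ≠ 0 := by
    intro h0
    have : 8 * (1 - a) * (1 - a') * (1 - (a * a' + d * (b * b'))) = 0 := by rw [hX, ← hf, h0]; ring
    simp only [mul_eq_zero, OfNat.ofNat_ne_zero, false_or] at this
    rcases this with (h | h) | h
    exacts [h1a h, h1a' h, h1a'' h]
  -- the argument is `(-α) · (d · w²)`
  set w := f * (4 * α ^ 2 * β)⁻¹ with hw
  have hw0 : w ≠ 0 :=
    mul_ne_zero hf0 (inv_ne_zero (mul_ne_zero (mul_ne_zero (by norm_num) (pow_ne_zero 2 hα)) hβ0))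
  have hN : -(α⁻¹ * A * (α⁻¹ * A') * (α⁻¹ * A'') * -((2 : v.adicCompletion K)⁻¹ * T)) = -α * (d * w ^ 2) := by
    have step : -(α⁻¹ * A * (α⁻¹ * A') * (α⁻¹ * A'') * -((2 : v.adicCompletion K)⁻¹ * T)) =
        (8 * (1 - a) * (1 - a') * (1 - (a * a' + d * (b * b')))) * (16 * α ^ 3 * β ^ 2)⁻¹ := by
      rw [hA, hA', hA'', hT, hβ'', hβ', hβ]
      rw [hβ] at hβ0; rw [hβ'] at hβ'0
      have hb'0 : b' ≠ 0 := (mul_ne_zero_iff.1 (mul_ne_zero_iff.1 hβ'0).1).2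
      field_simp
      ring
    rw [step, hX, hw]
    field_simp
    ring
  rw [hN, hilbertSymbol_adicCompletion_mul_right K v (neg_ne_zero.2 hα) (mul_ne_zero hd0 (pow_ne_zero 2 hw0)) hα,
    hilbertSymbol_self_neg hα, one_mul, hilbertSymbol_mul_sq_right α d hw0]

omit [MeasurableSpace (v.adicCompletion K)] [BorelSpace (v.adicCompletion K)] in
/-- `|αβ|^{1/2} = |α|^{1/2} |β|^{1/2}` (as complex numbers). [cite: Weil1964, Chap. I n° 14, p. 161] -/
theorem sqrt_normAbs_mul (α β : v.adicCompletion K) :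
    ((Real.sqrt (normAbs (v.adicCompletion K) (α * β)) : ℝ) : ℂ) =
      (Real.sqrt (normAbs (v.adicCompletion K) α) : ℂ) * (Real.sqrt (normAbs (v.adicCompletion K) β) : ℂ) := by
  rw [map_mul, NNReal.coe_mul, Real.sqrt_mul (NNReal.coe_nonneg _), Complex.ofReal_mul]

/-- **THE CROSS-LINE IDENTITY** `Φ₂ Φ₂' Φ₁'' = (α, d)_v · Φ₁ Φ₁' Φ₂''` for the explicit characters of the two lines
`δ₁`, `δ₂ = αδ₁` at three points `x, y, xy` of the big cell (coordinates `(a,b), (a',b')`, product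
`(aa' + dbb', ab' + ba')`; line-2 data `d₂ = α²d`, `b₂ = b/α`), given the two Schur-scalar cocycles.
[cite: Weil1964, Chap. I n° 14 Thm. 2 Cor. 2, p. 162; Chap. II n° 28 (28), p. 177] -/
theorem crossLine_character_identity (hψ : ψ.IsContinuousNontrivial)
    {α a b a' b' d d₂ b₂ b₂' τ : v.adicCompletion K} (hα : α ≠ 0) (hd₂ : d₂ = α ^ 2 * d) (hb₂ : b₂ = α⁻¹ * b)
    (hb₂' : b₂' = α⁻¹ * b') (h₁ : a ^ 2 - d * b ^ 2 = 1) (h₂ : a' ^ 2 - d * b' ^ 2 = 1)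
    (hβ : d * b * τ⁻¹ ≠ 0) (hβ' : d * b' * τ⁻¹ ≠ 0) (hβ'' : d * (a * b' + b * a') * τ⁻¹ ≠ 0)
    (hA : 1 - a ≠ 0) (hA' : 1 - a' ≠ 0) (hA'' : 1 - (a * a' + d * (b * b')) ≠ 0)
    (lam₁ lam₁' lam₁'' lam₂ lam₂' lam₂'' : ℂ)
    (hcoc₁ : lam₁ * lam₁' * (weilGauss ψ μ (-((2 : v.adicCompletion K)⁻¹ *
        (d * b' * τ⁻¹ * (((d * b * τ⁻¹)⁻¹ * a + a' * (d * b' * τ⁻¹)⁻¹) * (d * b' * τ⁻¹))))) *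
      (Real.sqrt (normAbs (v.adicCompletion K)
        (d * b' * τ⁻¹ * (((d * b * τ⁻¹)⁻¹ * a + a' * (d * b' * τ⁻¹)⁻¹) * (d * b' * τ⁻¹)))) : ℂ)) = lam₁'')
    (hcoc₂ : lam₂ * lam₂' * (weilGauss ψ μ (-((2 : v.adicCompletion K)⁻¹ *
        (d₂ * b₂' * τ⁻¹ * (((d₂ * b₂ * τ⁻¹)⁻¹ * a + a' * (d₂ * b₂' * τ⁻¹)⁻¹) * (d₂ * b₂' * τ⁻¹))))) *
      (Real.sqrt (normAbs (v.adicCompletion K)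
        (d₂ * b₂' * τ⁻¹ * (((d₂ * b₂ * τ⁻¹)⁻¹ * a + a' * (d₂ * b₂' * τ⁻¹)⁻¹) * (d₂ * b₂' * τ⁻¹)))) : ℂ)) = lam₂'') :
    (lam₂ * ((Real.sqrt (normAbs (v.adicCompletion K) (d₂ * b₂ * τ⁻¹)) : ℂ))⁻¹ *
        weilGauss ψ μ ((d₂ * b₂ * τ⁻¹)⁻¹ * (1 - a))) *
      (lam₂' * ((Real.sqrt (normAbs (v.adicCompletion K) (d₂ * b₂' * τ⁻¹)) : ℂ))⁻¹ *
        weilGauss ψ μ ((d₂ * b₂' * τ⁻¹)⁻¹ * (1 - a'))) *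
      (lam₁'' * ((Real.sqrt (normAbs (v.adicCompletion K) (d * (a * b' + b * a') * τ⁻¹)) : ℂ))⁻¹ *
        weilGauss ψ μ ((d * (a * b' + b * a') * τ⁻¹)⁻¹ * (1 - (a * a' + d * (b * b'))))) =
    (hilbertSymbol (v.adicCompletion K) α d : ℂ) *
      ((lam₁ * ((Real.sqrt (normAbs (v.adicCompletion K) (d * b * τ⁻¹)) : ℂ))⁻¹ *
          weilGauss ψ μ ((d * b * τ⁻¹)⁻¹ * (1 - a))) *
        (lam₁' * ((Real.sqrt (normAbs (v.adicCompletion K) (d * b' * τ⁻¹)) : ℂ))⁻¹ *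
          weilGauss ψ μ ((d * b' * τ⁻¹)⁻¹ * (1 - a'))) *
        (lam₂'' * ((Real.sqrt (normAbs (v.adicCompletion K) (d₂ * (a * b₂' + b₂ * a') * τ⁻¹)) : ℂ))⁻¹ *
          weilGauss ψ μ ((d₂ * (a * b₂' + b₂ * a') * τ⁻¹)⁻¹ * (1 - (a * a' + d₂ * (b₂ * b₂')))))) := by
  haveI : CharZero (v.adicCompletion K) := charZero_of_injective_algebraMap (algebraMap K _).injective
  have htwo : (2 : v.adicCompletion K) ≠ 0 := two_ne_zero
  have hd0 : d ≠ 0 := (mul_ne_zero_iff.1 (mul_ne_zero_iff.1 hβ).1).1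
  have hb0 : b ≠ 0 := (mul_ne_zero_iff.1 (mul_ne_zero_iff.1 hβ).1).2
  have hb'0 : b' ≠ 0 := (mul_ne_zero_iff.1 (mul_ne_zero_iff.1 hβ').1).2
  have hτ0 : τ ≠ 0 := fun h => (mul_ne_zero_iff.1 hβ).2 (by rw [h, inv_zero])
  have hb''0 : a * b' + b * a' ≠ 0 := (mul_ne_zero_iff.1 (mul_ne_zero_iff.1 hβ'').1).2
  -- ### line 2 in terms of line 1
  subst hd₂ hb₂ hb₂'
  have e1 : α ^ 2 * d * (α⁻¹ * b) * τ⁻¹ = α * (d * b * τ⁻¹) := by field_simp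
  have e2 : α ^ 2 * d * (α⁻¹ * b') * τ⁻¹ = α * (d * b' * τ⁻¹) := by field_simp
  have e3 : α ^ 2 * d * (a * (α⁻¹ * b') + α⁻¹ * b * a') * τ⁻¹ = α * (d * (a * b' + b * a') * τ⁻¹) := by
    field_simp
  have e4 : a * a' + α ^ 2 * d * (α⁻¹ * b * (α⁻¹ * b')) = a * a' + d * (b * b') := by field_simp
  rw [e1, e2] at hcoc₂
  rw [e1, e2, e3, e4]
  -- ### atoms `β, β', β'', A, A', A'', T`
  obtain ⟨β, hβe⟩ : ∃ β, d * b * τ⁻¹ = β := ⟨_, rfl⟩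
  obtain ⟨β', hβe'⟩ : ∃ β', d * b' * τ⁻¹ = β' := ⟨_, rfl⟩
  obtain ⟨β'', hβe''⟩ : ∃ β'', d * (a * b' + b * a') * τ⁻¹ = β'' := ⟨_, rfl⟩
  rw [hβe] at hβ hcoc₁ hcoc₂ ⊢; rw [hβe'] at hβ' hcoc₁ hcoc₂ ⊢; rw [hβe''] at hβ'' ⊢
  obtain ⟨T, hTe⟩ : ∃ T, β' * ((β⁻¹ * a + a' * β'⁻¹) * β') = T := ⟨_, rfl⟩
  have e5 : α * β' * (((α * β)⁻¹ * a + a' * (α * β')⁻¹) * (α * β')) = α * T := by rw [← hTe]; field_simp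
  rw [hTe] at hcoc₁; rw [e5] at hcoc₂
  obtain ⟨A, hAe⟩ : ∃ A, β⁻¹ * (1 - a) = A := ⟨_, rfl⟩
  obtain ⟨A', hAe'⟩ : ∃ A', β'⁻¹ * (1 - a') = A' := ⟨_, rfl⟩
  obtain ⟨A'', hAe''⟩ : ∃ A'', β''⁻¹ * (1 - (a * a' + d * (b * b'))) = A'' := ⟨_, rfl⟩
  have e6 : (α * β)⁻¹ * (1 - a) = α⁻¹ * A := by rw [← hAe, mul_inv, mul_assoc]
  have e7 : (α * β')⁻¹ * (1 - a') = α⁻¹ * A' := by rw [← hAe', mul_inv, mul_assoc]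
  have e8 : (α * β'')⁻¹ * (1 - (a * a' + d * (b * b'))) = α⁻¹ * A'' := by rw [← hAe'', mul_inv, mul_assoc]
  rw [e6, e7, e8, hAe, hAe', hAe'']
  have hA0 : A ≠ 0 := by rw [← hAe]; exact mul_ne_zero (inv_ne_zero hβ) hA
  have hA'0 : A' ≠ 0 := by rw [← hAe']; exact mul_ne_zero (inv_ne_zero hβ') hA'
  have hA''0 : A'' ≠ 0 := by rw [← hAe'']; exact mul_ne_zero (inv_ne_zero hβ'') hA''
  have hT0 : T ≠ 0 := by
    have e : T = β⁻¹ * β'' * β' := by rw [← hTe, ← hβe'', ← hβe, ← hβe']; field_simp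
    rw [e]; exact mul_ne_zero (mul_ne_zero (inv_ne_zero hβ) hβ'') hβ'
  -- ### the sign and the cross ratio
  have hsign : hilbertSymbol (v.adicCompletion K) α (-(α⁻¹ * A * (α⁻¹ * A') * (α⁻¹ * A'') *
      -((2 : v.adicCompletion K)⁻¹ * T))) = hilbertSymbol (v.adicCompletion K) α d :=
    hilbertSymbol_crossRatio_eq K v hα h₁ h₂ hβe.symm hβe'.symm hβe''.symm hβ hβ' hβ'' hAe.symm hAe'.symm hAe''.symm
      hA0 hA'0 hA''0 hTe.symm
  have hX := weilGauss_crossRatio K v μ hψ hα (mul_ne_zero (inv_ne_zero hα) hA0) (mul_ne_zero (inv_ne_zero hα) hA'0)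
    (mul_ne_zero (inv_ne_zero hα) hA''0) (neg_ne_zero.2 (mul_ne_zero (inv_ne_zero htwo) hT0)) (x₄ := -(2⁻¹ * T))
  rw [hsign, mul_inv_cancel_left₀ hα, mul_inv_cancel_left₀ hα, mul_inv_cancel_left₀ hα] at hX
  -- ### square roots
  have hs0 : ∀ {x : v.adicCompletion K}, x ≠ 0 → (Real.sqrt (normAbs (v.adicCompletion K) x) : ℂ) ≠ 0 := by
    intro x hx
    rw [Complex.ofReal_ne_zero]
    have hpos : 0 < normAbs (v.adicCompletion K) x := pos_iff_ne_zero.2 ((map_ne_zero _).2 hx)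
    exact (Real.sqrt_pos.2 (by exact_mod_cast hpos)).ne'
  have hr0 := hs0 hα
  rw [sqrt_normAbs_mul K v α β, sqrt_normAbs_mul K v α β', sqrt_normAbs_mul K v α β''] 
  rw [sqrt_normAbs_mul K v α T, show -((2 : v.adicCompletion K)⁻¹ * (α * T)) = α * -(2⁻¹ * T) by ring] at hcoc₂
  rw [← hcoc₁, ← hcoc₂]
  have hsβ := hs0 hβ; have hsβ' := hs0 hβ'; have hsβ'' := hs0 hβ''; have hsT := hs0 hT0
  generalize weilGauss ψ μ (α⁻¹ * A) = g₁ at hX ⊢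
  generalize weilGauss ψ μ (α⁻¹ * A') = g₂ at hX ⊢
  generalize weilGauss ψ μ (α⁻¹ * A'') = g₃ at hX ⊢
  generalize weilGauss ψ μ A = G₁ at hX ⊢
  generalize weilGauss ψ μ A' = G₂ at hX ⊢
  generalize weilGauss ψ μ A'' = G₃ at hX ⊢
  generalize weilGauss ψ μ (-(2⁻¹ * T)) = gT at hX ⊢
  generalize weilGauss ψ μ (α * -(2⁻¹ * T)) = gT' at hX ⊢
  generalize (hilbertSymbol (v.adicCompletion K) α d : ℂ) = H at hX ⊢
  generalize ((Real.sqrt (normAbs (v.adicCompletion K) α) : ℝ) : ℂ) = r at hX hr0 ⊢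
  generalize ((Real.sqrt (normAbs (v.adicCompletion K) β) : ℝ) : ℂ) = s at hsβ ⊢
  generalize ((Real.sqrt (normAbs (v.adicCompletion K) β') : ℝ) : ℂ) = s' at hsβ' ⊢
  generalize ((Real.sqrt (normAbs (v.adicCompletion K) β'') : ℝ) : ℂ) = s'' at hsβ'' ⊢
  generalize ((Real.sqrt (normAbs (v.adicCompletion K) T) : ℝ) : ℂ) = sT at hsT ⊢
  have hX' : gT * g₁ * g₂ * G₃ = H * (gT' * G₁ * G₂ * g₃ * r ^ 2) := by
    apply mul_right_cancel₀ hr0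
    linear_combination hX
  field_simp
  linear_combination (lam₁ * lam₁' * lam₂ * lam₂') * hX'

end Literature.NumberTheory.Weil1964

end
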